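import Summits.ValiantsHypothesis.ValiantsHypothesis.Theorems.Depth4DoorCeilings
import HarnessLib

/-!
# Depth4 — the PER/DET SEAM of crux `Depth4HomFour` (support for `stmt-ValiantsHypothesis-11333`;
# lens 4, g32, O25 v2, critic CALL GO)

SEAM READING of the door axis = a CONDITIONAL LINE: A is NOT a necessary piece of crux 11333
(11333 ⇏ A), so A ∧ B is not a decomposition node of record; NOT a rung; 0 S-currency; closes no
item; crux 11333 / the fixed-slope window / VP ≠ VNP untouched.

After `Depth4DoorCeilings` (p817347) every `per`/`det`-BLIND method — every lower bound that is also
valid for `det_n` — is capped at `det`'s fixed door `c₀` (`exists_door_detPoly`), while the crux asks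
`per_n` to pass EVERY door.  This file reads crux 11333 along that seam, in ONE currency (powers of
`D4(det_n)`, `D4 = homDepthFourCircuitSize`):

* BLIND HALF `A` («Tavenas is tight for DET at homogeneous depth four»: a FIXED power of `det_n`'s
  cost passes the unit-slope door eventually): `∃ k m₀, ∀ n ≥ m₀, (n+2)^⌊√n⌋ ≤ D4(det_n)^(k+1)`.
  A statement about a `VP` family, independent of `VH` and NOT implied by the crux; its IMM sibling
  is Kumar–Saraf 2017 Thm 1.2 (`kumarSaraf2017_imm_homDepthFour`); for `det` only the one-sentence
  `VQP`-transfer Cor. 1.4 is PRINT-CLAIMED; blind methods may attack it.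
* SENSITIVE HALF `B` («RelGap»: `per_n` beats every power of `det_n`'s depth-4 cost, i.o.):
  `∀ c m₀, ∃ n ≥ m₀, D4(det_n)^c < D4(per_n)`.  `per`-specific; a CONSEQUENCE of the crux
  (`relGap_of_depth4HomFour`), strictness NOT claimed; its rung `c = 1, ∃ n` is the conclusion of
  `Depth4DoorCeilings.depth4HomFour_separates` and is itself open.

Contents: `homDepthFourCircuitSize_perPoly_le_pow` (Ryser's ceiling in door currency,
`D4(per_n) ≤ (n+2)^(n+3)`); `depth4HomFour_iff_io` (the i.o. NORMAL FORM of the crux: a witness of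
door `c + m₀ + 3` is `≥ m₀`); `depth4HomFour_of_detFloor_of_relGap` (the glue `A → B → crux`);
`relGap_of_depth4HomFour` (`crux → B`); `relGap_iff_depth4HomFour_of_detFloor` (`A → (B ↔ crux)`:
under `A` the two coincide — the zero-sum caveat, displayed).  Used by name, nothing restated:
`Depth4DoorCeilings.exists_door_detPoly`, `Depth4DoorCeilings.homDepthFourCircuitSize_perPoly_le`,
`Nat.le_sqrt'`, `pow_mul`, `pow_le_pow_left₀`, `pow_le_pow_right₀`.
-/

set_option linter.dupNamespace false

noncomputable section

open Literature.Computability.AlgebraicComplexity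

namespace Summit.ValiantsHypothesis.ValiantsHypothesis.Theorems.Depth4DetSeam

variable (K : Type*) [CommRing K]

/-- `per`'s Ryser ceiling in door currency: `D4(per_n) ≤ n² + (n+1)·2^n + 1 ≤ (n+2)^(n+3)`.
[cite: Ryser1963, Ch. 2 Thm 4.1] [cite: KumarSaraf2017, §3] -/
theorem homDepthFourCircuitSize_perPoly_le_pow (n : ℕ) :
    homDepthFourCircuitSize (perPoly (Fin n) K) ≤ ((n + 2 : ℕ∞) ^ (n + 3)) := by
  refine le_trans (Depth4DoorCeilings.homDepthFourCircuitSize_perPoly_le K n) ?_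
  -- `n² + (n+1)·2^n + 1 ≤ 2·(n+2)^(n+2) ≤ (n+2)^(n+3)` in `ℕ`
  have h1 : n ^ 2 + 1 ≤ (n + 2) ^ (n + 2) := by
    have hsq : n ^ 2 + 1 ≤ (n + 2) ^ 2 := by
      have : (n + 2) ^ 2 = n ^ 2 + 4 * n + 4 := by ring
      omega
    exact hsq.trans (Nat.pow_le_pow_right (by omega) (by omega))
  have h2 : (n + 1) * 2 ^ n ≤ (n + 2) ^ (n + 2) :=
    calc (n + 1) * 2 ^ n ≤ (n + 2) * (n + 2) ^ n :=
          Nat.mul_le_mul (by omega) (Nat.pow_le_pow_left (by omega) n)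
      _ = (n + 2) ^ (n + 1) := by ring
      _ ≤ (n + 2) ^ (n + 2) := Nat.pow_le_pow_right (by omega) (by omega)
  have h3 : n ^ 2 + (n + 1) * 2 ^ n + 1 ≤ (n + 2) ^ (n + 3) :=
    calc n ^ 2 + (n + 1) * 2 ^ n + 1 ≤ (n + 2) ^ (n + 2) + (n + 2) ^ (n + 2) := by omega
      _ = 2 * (n + 2) ^ (n + 2) := by ring
      _ ≤ (n + 2) * (n + 2) ^ (n + 2) := Nat.mul_le_mul_right _ (by omega)
      _ = (n + 2) ^ (n + 3) := by ring
  exact_mod_cast h3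

/-- **The crux is automatically infinitely-often**: in `∀ c ∃ n, (n+2)^(c⌊√n⌋+c) < D4(per_n)` every
witness `n` of door `c + m₀ + 3` satisfies `n ≥ m₀` (else Ryser's ceiling `(n+2)^(n+3)` is below the
door), so the body is equivalent to its `∀ c m₀ ∃ n ≥ m₀` form. [cite: KumarSaraf2017, §3]
[cite: Ryser1963, Ch. 2 Thm 4.1] -/
theorem depth4HomFour_iff_io :
    (∀ c : ℕ, ∃ n : ℕ, ((n + 2 : ℕ∞) ^ (c * Nat.sqrt n + c)) <
        homDepthFourCircuitSize (perPoly (Fin n) K)) ↔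
    (∀ c m₀ : ℕ, ∃ n : ℕ, m₀ ≤ n ∧ ((n + 2 : ℕ∞) ^ (c * Nat.sqrt n + c)) <
        homDepthFourCircuitSize (perPoly (Fin n) K)) := by
  refine ⟨fun h c m₀ => ?_, fun h c => (h c 0).imp fun n hn => hn.2⟩
  obtain ⟨n, hn⟩ := h (c + m₀ + 3)
  have h12 : (1 : ℕ∞) ≤ (n + 2 : ℕ∞) := one_le_two.trans le_add_self
  have hn₀ : m₀ ≤ n := by
    by_contra hlt
    have hexp : n + 3 ≤ (c + m₀ + 3) * Nat.sqrt n + (c + m₀ + 3) :=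
      le_trans (by omega) (Nat.le_add_left (c + m₀ + 3) _)
    have hle : homDepthFourCircuitSize (perPoly (Fin n) K) ≤
        (n + 2 : ℕ∞) ^ ((c + m₀ + 3) * Nat.sqrt n + (c + m₀ + 3)) :=
      (homDepthFourCircuitSize_perPoly_le_pow K n).trans (pow_le_pow_right₀ h12 hexp)
    exact (not_lt.2 hle) hn
  refine ⟨n, hn₀, lt_of_le_of_lt (pow_le_pow_right₀ h12 ?_) hn⟩
  exact Nat.add_le_add (Nat.mul_le_mul_right _ (by omega)) (by omega)

/-- **SEAM GLUE `A → B → Depth4HomFour`**: if `det_n` needs homogeneous `ΣΠΣΠ` size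
`≥ (n+2)^(⌊√n⌋/(k+1))` for all large `n` (blind half: Tavenas tight for `det`) and `per_n` beats every
power of `det_n`'s depth-4 cost infinitely often (sensitive half), then `per_n` passes every door
(door `c` at any `n ≥ c²` where `D4(det_n)^((k+1)(c+1)) < D4(per_n)`: `c⌊√n⌋ + c ≤ ⌊√n⌋(c+1)`). [cite: Tavenas2015, Thm 1]
[cite: KumarSaraf2017, Thm 1.2] -/
theorem depth4HomFour_of_detFloor_of_relGap
    (hA : ∃ k m₀ : ℕ, ∀ n : ℕ, m₀ ≤ n →
      ((n + 2 : ℕ∞) ^ Nat.sqrt n) ≤ homDepthFourCircuitSize (detPoly (Fin n) K) ^ (k + 1))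
    (hB : ∀ c m₀ : ℕ, ∃ n : ℕ, m₀ ≤ n ∧
      homDepthFourCircuitSize (detPoly (Fin n) K) ^ c <
        homDepthFourCircuitSize (perPoly (Fin n) K)) :
    ∀ c : ℕ, ∃ n : ℕ, ((n + 2 : ℕ∞) ^ (c * Nat.sqrt n + c)) <
      homDepthFourCircuitSize (perPoly (Fin n) K) := by
  intro c
  obtain ⟨k, m₀, hA⟩ := hA
  obtain ⟨n, hn, hlt⟩ := hB ((k + 1) * (c + 1)) (max m₀ (c ^ 2))
  have hm₀ : m₀ ≤ n := le_of_max_le_left hn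
  have hc : c ≤ Nat.sqrt n := Nat.le_sqrt'.2 (le_of_max_le_right hn)
  have h12 : (1 : ℕ∞) ≤ (n + 2 : ℕ∞) := one_le_two.trans le_add_self
  have hexp : c * Nat.sqrt n + c ≤ Nat.sqrt n * (c + 1) :=
    calc c * Nat.sqrt n + c ≤ c * Nat.sqrt n + Nat.sqrt n := Nat.add_le_add_left hc _
      _ = Nat.sqrt n * (c + 1) := by ring
  refine ⟨n, lt_of_le_of_lt ?_ hlt⟩
  calc (n + 2 : ℕ∞) ^ (c * Nat.sqrt n + c)
      ≤ (n + 2 : ℕ∞) ^ (Nat.sqrt n * (c + 1)) := pow_le_pow_right₀ h12 hexp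
    _ = ((n + 2 : ℕ∞) ^ Nat.sqrt n) ^ (c + 1) := pow_mul _ _ _
    _ ≤ (homDepthFourCircuitSize (detPoly (Fin n) K) ^ (k + 1)) ^ (c + 1) :=
        pow_le_pow_left₀ zero_le (hA n hm₀) _
    _ = homDepthFourCircuitSize (detPoly (Fin n) K) ^ ((k + 1) * (c + 1)) := (pow_mul _ _ _).symm

/-- **`Depth4HomFour → B`**: with `det`'s door `c₀` (`exists_door_detPoly`), door `c·c₀` of `per`
at an `n ≥ m₀` (`depth4HomFour_iff_io`) beats `D4(det_n)^c ≤ (n+2)^((c₀⌊√n⌋+c₀)·c)`.  B is a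
consequence of the crux; that B is STRICTLY weaker is NOT claimed (under A they coincide,
relGap_iff_depth4HomFour_of_detFloor). [cite: Tavenas2015, Thm 1] -/
theorem relGap_of_depth4HomFour
    (h : ∀ c : ℕ, ∃ n : ℕ, ((n + 2 : ℕ∞) ^ (c * Nat.sqrt n + c)) <
      homDepthFourCircuitSize (perPoly (Fin n) K)) :
    ∀ c m₀ : ℕ, ∃ n : ℕ, m₀ ≤ n ∧
      homDepthFourCircuitSize (detPoly (Fin n) K) ^ c <
        homDepthFourCircuitSize (perPoly (Fin n) K) := by
  intro c m₀
  obtain ⟨c₀, hc₀⟩ := Depth4DoorCeilings.exists_door_detPoly K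
  obtain ⟨n, hn, hlt⟩ := (depth4HomFour_iff_io K).1 h (c * c₀) m₀
  refine ⟨n, hn, lt_of_le_of_lt ?_ hlt⟩
  calc homDepthFourCircuitSize (detPoly (Fin n) K) ^ c
      ≤ ((n + 2 : ℕ∞) ^ (c₀ * Nat.sqrt n + c₀)) ^ c := pow_le_pow_left₀ zero_le (hc₀ n) c
    _ = (n + 2 : ℕ∞) ^ ((c₀ * Nat.sqrt n + c₀) * c) := (pow_mul _ _ _).symm
    _ = (n + 2 : ℕ∞) ^ (c * c₀ * Nat.sqrt n + c * c₀) := by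
        congr 1
        ring

/-- **Under the blind half, the sensitive half IS the crux** (`A → (B ↔ Depth4HomFour)`): the seam
relocates the blind-attackable content of crux 11333 into a statement about `det`; it does not
shorten the distance (zero-sum caveat, displayed). [cite: Tavenas2015, Thm 1]
[cite: KumarSaraf2017, Thm 1.2] -/
theorem relGap_iff_depth4HomFour_of_detFloor
    (hA : ∃ k m₀ : ℕ, ∀ n : ℕ, m₀ ≤ n →
      ((n + 2 : ℕ∞) ^ Nat.sqrt n) ≤ homDepthFourCircuitSize (detPoly (Fin n) K) ^ (k + 1)) :
    (∀ c m₀ : ℕ, ∃ n : ℕ, m₀ ≤ n ∧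
      homDepthFourCircuitSize (detPoly (Fin n) K) ^ c <
        homDepthFourCircuitSize (perPoly (Fin n) K)) ↔
    (∀ c : ℕ, ∃ n : ℕ, ((n + 2 : ℕ∞) ^ (c * Nat.sqrt n + c)) <
      homDepthFourCircuitSize (perPoly (Fin n) K)) :=
  ⟨depth4HomFour_of_detFloor_of_relGap K hA, relGap_of_depth4HomFour K⟩

end Summit.ValiantsHypothesis.ValiantsHypothesis.Theorems.Depth4DetSeam

end
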